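import Mathlib
import Summits.NavierStokesRegularity.NavierStokesRegularity.Theorems.EfficiencyFloorMaximiserSetRigidityRotatingDrift
import Summits.NavierStokesRegularity.NavierStokesRegularity.Theorems.EfficiencyFloorMaximiserSetRigidityOrbitBlowup
import Summits.NavierStokesRegularity.NavierStokesRegularity.Theorems.EfficiencyFloorMaximiserSetRigidityOrbitL3
import Summits.NavierStokesRegularity.NavierStokesRegularity.Theorems.EfficiencyFloorMaximiserSetRigidityOrbitClassical
import Literature.Analysis.FluidPDE.NSSereginL3BlowupHolds
import Literature.Analysis.FluidPDE.TaoFiniteEnergyLerayHopf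
import Literature.Analysis.FluidPDE.LerayHopfFinalWeakSlice
import Literature.Analysis.FluidPDE.NSLerayStrongLocalExistence
import Literature.Analysis.FluidPDE.AxisymmetricNoSwirlWeightedEnstrophyProofs
import Literature.Analysis.FluidPDE.LeraySchemePressureBounds
import Literature.Analysis.FluidPDE.VorticityCalculus
import HarnessLib

/-!
# Route `EfficiencyFloor`, crux `MaximiserSetRigidity` (stmt-NavierStokesRegularity-25512), part (b):
# THE ROTATING COLLAPSE LIOUVILLE THEOREM (L⁺_rot) — PROVED; part (b) is now unconditional, and
# `MaximiserSetRigidity ⟸ part (a)` alone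

Helper file (`--supports stmt-NavierStokesRegularity-25512`). Assembly of the orbit argument (bricks `…RotatingDrift`,
`…OrbitBlowup`, `…OrbitL3`, `…OrbitTimeDeriv`, `…OrbitExp`, `…OrbitClassical`) with three PROVED tree theorems:
Seregin's `L³` blow-up criterion `Literature.Analysis.FluidPDE.seregin_L3_blowup_holds` (Seregin 2012, Thm 1.1: a
maximal smooth Leray–Hopf solution with `u(0) ∈ L³`, bounded on closed sub-slabs, has `‖u(t)‖₃ → ∞`), Tao's
"finite-energy classical solutions are Leray–Hopf" (`isLerayHopfOn_of_finiteEnergy`) and the weak final slice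
(`exists_isLerayHopfOn_update_of_forall_lt`).

THE THEOREM (`rotatingCollapseLiouville_noDrift_holds`). For `ν > 0`: no smooth divergence-free `m` with
`D⁰m, D¹m, D²m ∈ L²(ℝ³)` and `∫|curl m|² > 0` solves `νΔm − (m·∇)m − ∇π = ((Wx)·∇)m − Wm + c′(m + (x·∇)m)` with
`π` smooth, `W` skew-adjoint and `c′ > 0` (the hypothesis `W ≠ 0` of (L⁺_rot) is not even needed). PROOF. With
`T = (2c′)⁻¹`, `λ(t) = (2c′(T−t))^{-1/2}` (`λ(0) = 1`), `R(t) = exp(φ(t)W)`, `φ = (2c′)⁻¹log(2c′(T−t))` (`R(0) = 1`),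
the rotating Leray orbit `u(t,x) = λR m(λR⁻¹x)` is a classical solution on `[0,T)` with `u(0) = m`
(`isClassicalNSSolutionOn_rotatingOrbit`), maximal at `T` (`not_hasSmoothExtensionPast_of_selfSimilarOrbit`: `m ≢ 0`,
`λ → ∞`), of energy `∫|u(t)|² = λ⁻¹∫|m|² ≤ ∫|m|²`, hence Leray–Hopf on every `[0,T′]`, `T′ < T` (Tao) and, after
redefining the slice at `T` by the weak limit, on `[0,T]`; `m ∈ H² ⊂ L^∞ ∩ L³` gives the sub-slab bound
`|u| ≤ λ(T′)‖m‖_∞` and `u(0) ∈ L³`. Seregin: `‖u(t)‖₃ → ∞`; but `‖u(t)‖₃ = ‖m‖₃ < ∞` for all `t < T`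
(`eLpNorm_three_selfSimilarSlice`). Contradiction.

CONSEQUENCES (by name). `rotatingCollapseLiouville_holds` = (L⁺_rot) with drift (via `rotatingCollapseLiouville_of_noDrift`);
`partB_holds` = the item's (b)-clause for every normalised maximiser, all `π, a, W, c′` — UNCONDITIONAL;
`maximiserSetRigidity_of_partA` = the route decl `MaximiserSetRigidity` from its clause (a) ALONE.

HONEST FRAMING: part (a) of stmt-25512 (finitely many maximiser orbits — the bet), `RigidExit`,
`NearMaximiserBoundedAmplification`, `LerayFloorGap`, `ProductionEfficiencyDecay` and Navier–Stokes regularity stay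
OPEN; no summit statement is proved. [folklore]
-/

noncomputable section

-- the problem directory repeats the summit name (`NavierStokesRegularity/NavierStokesRegularity`)
set_option linter.dupNamespace false

namespace Summit.NavierStokesRegularity.NavierStokesRegularity.Theorems

namespace MaximiserSetRigidity

namespace ProfileLiouville

open MeasureTheory Set Filter Topology Function InnerProductSpace
open scoped RealInnerProductSpace ContDiff Laplacian ENNReal NNReal
open Literature.Analysis Literature.Analysis.FluidPDE RotatingOrbit

/-- The scale `λ(t) = (2c′(T−t))^{-1/2}` tends to `+∞` as `t → T⁻`. [folklore] -/
theorem tendsto_lerayScale_atTop {c' T : ℝ} (hc' : 0 < c') :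
    Tendsto (fun t => (Real.sqrt (2 * c' * (T - t)))⁻¹) (𝓝[<] T) atTop := by
  have h1 : Tendsto (fun t => 2 * c' * (T - t)) (𝓝[<] T) (𝓝[>] 0) := by
    refine tendsto_nhdsWithin_iff.2 ⟨?_, ?_⟩
    · have hc : Continuous fun t : ℝ => 2 * c' * (T - t) := by continuity
      have := hc.tendsto T
      simp only [sub_self, mul_zero] at this
      exact tendsto_nhdsWithin_of_tendsto_nhds this
    · filter_upwards [self_mem_nhdsWithin] with t ht
      exact lerayScale_arg_pos hc' ht
  have h2 : Tendsto Real.sqrt (𝓝[>] (0 : ℝ)) (𝓝[>] 0) := by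
    refine tendsto_nhdsWithin_iff.2 ⟨?_, ?_⟩
    · have := Real.continuous_sqrt.tendsto 0
      rw [Real.sqrt_zero] at this
      exact tendsto_nhdsWithin_of_tendsto_nhds this
    · filter_upwards [self_mem_nhdsWithin] with x hx
      exact Real.sqrt_pos.2 hx
  exact tendsto_inv_nhdsGT_zero.comp (h2.comp h1)

/-- **(L⁺_rot), driftless — PROVED.** For `ν > 0`: no smooth divergence-free `m` with `D⁰m, D¹m, D²m ∈ L²` and
`Z(m) > 0` solves `νΔm − (m·∇)m − ∇π = ((Wx)·∇)m − Wm + c′(m + (x·∇)m)` with `π` smooth, `W` skew-adjoint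
(`W ≠ 0` is carried but unused) and `c′ > 0`. Rotating Leray orbit + Tao (classical finite energy ⇒ Leray–Hopf) +
weak final slice + Seregin 2012 (`seregin_L3_blowup_holds`) + scale invariance of `L³`. [folklore] -/
theorem rotatingCollapseLiouville_noDrift_holds :
    ∀ (ν : ℝ), 0 < ν → ∀ (m : EuclideanSpace ℝ (Fin 3) → EuclideanSpace ℝ (Fin 3)) (π : EuclideanSpace ℝ (Fin 3) → ℝ)
      (W : EuclideanSpace ℝ (Fin 3) →L[ℝ] EuclideanSpace ℝ (Fin 3)) (c' : ℝ),
      (ContDiff ℝ (⊤ : ℕ∞) m ∧ Literature.Analysis.FluidPDE.VectorCalculus.IsDivFree m ∧ (∫⁻ x,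
        ‖iteratedFDeriv ℝ 0 m x‖ₑ ^ 2 < ⊤) ∧ (∫⁻ x, ‖iteratedFDeriv ℝ 1 m x‖ₑ ^ 2 < ⊤) ∧ (∫⁻ x, ‖iteratedFDeriv ℝ
        2 m x‖ₑ ^ 2 < ⊤)) → 0 < (∫ x, ‖Literature.Analysis.FluidPDE.curl m x‖ ^ 2) → ContDiff ℝ (⊤ : ℕ∞) π → (∀ x
        y : EuclideanSpace ℝ (Fin 3), ⟪W x, y⟫_ℝ = -⟪x, W y⟫_ℝ) → W ≠ 0 → 0 < c' → ¬ (∀ x : EuclideanSpace ℝ (Fin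
        3), ν • Laplacian.laplacian m x - Literature.Analysis.FluidPDE.convect m m x - gradient π x =
        (fderiv ℝ m x (W x) - W (m x)) + c' • (m x + fderiv ℝ m x x)) := by
  intro ν hν m π W c' hadm hZ hπ hW _hW0 hc' heq
  obtain ⟨hm, hdiv, h0, h1, h2⟩ := hadm
  have hmc : Continuous m := hm.continuous
  -- the collapse time and the scales
  set T : ℝ := (2 * c')⁻¹ with hT_def
  have hT : 0 < T := by positivity
  have h2cT : 2 * c' * T = 1 := by rw [hT_def]; field_simp
  set lam : ℝ → ℝ := fun t => (Real.sqrt (2 * c' * (T - t)))⁻¹ with hlam_def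
  set φ : ℝ → ℝ := fun t => (2 * c')⁻¹ * Real.log (2 * c' * (T - t)) with hφ_def
  set Rot : ℝ → (EuclideanSpace ℝ (Fin 3) ≃ₗᵢ[ℝ] EuclideanSpace ℝ (Fin 3)) := fun t =>
    Unitary.linearIsometryEquiv ⟨NormedSpace.exp (φ t • W), exp_smul_mem_unitary hW (φ t)⟩ with hRot_def
  have hRot : ∀ t v, Rot t v = NormedSpace.exp (φ t • W) v := fun t v => unitaryExp_apply hW (φ t) v
  have hRot' : ∀ t v, (Rot t).symm v = NormedSpace.exp ((-φ t) • W) v := fun t v =>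
    unitaryExp_symm_apply hW (φ t) v
  set u : ℝ → EuclideanSpace ℝ (Fin 3) → EuclideanSpace ℝ (Fin 3) := fun t x =>
    lam t • Rot t (m (lam t • (Rot t).symm x)) with hu_def
  set p : ℝ → EuclideanSpace ℝ (Fin 3) → ℝ := fun t x => lam t ^ 2 * π (lam t • (Rot t).symm x) with hp_def
  -- the orbit is classical on `(−∞, T)`, hence on `[0, T)` and on every `[0, T']`, `T' < T`
  have hcl : IsClassicalNSSolutionOn (Iio T) ν 0 u p :=
    isClassicalNSSolutionOn_rotatingOrbit hc' hm hπ hdiv heq lam φ (fun t => rfl) (fun t => rfl) Rot hRot hRot'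
      u p (fun t x => rfl) (fun t x => rfl)
  have hcl0 : IsClassicalNSSolutionOn (Ico 0 T) ν 0 u p := hcl.mono Ico_subset_Iio_self (uniqueDiffOn_Ico 0 T)
  -- facts about the scale
  have hlam_pos : ∀ t, t < T → 0 < lam t := fun t ht => lerayScale_pos hc' ht
  have hlam0 : lam 0 = 1 := by
    simp only [hlam_def, sub_zero, h2cT, Real.sqrt_one, inv_one]
  have hlam_ge : ∀ t, 0 ≤ t → t < T → 1 ≤ lam t := by
    intro t ht0 htT
    have hpos := lerayScale_arg_pos hc' htT
    have hle : 2 * c' * (T - t) ≤ 1 := by nlinarith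
    rw [hlam_def]
    exact (one_le_inv₀ (Real.sqrt_pos.2 hpos)).2 (Real.sqrt_le_one.2 hle)
  have hlam_mono : ∀ s t, s ≤ t → t < T → lam s ≤ lam t := by
    intro s t hst htT
    have hpos := lerayScale_arg_pos hc' htT
    exact inv_anti₀ (Real.sqrt_pos.2 hpos) (Real.sqrt_le_sqrt (by nlinarith))
  have hlam_tend : Tendsto lam (𝓝[<] T) atTop := tendsto_lerayScale_atTop hc'
  -- `u 0 = m`
  have hφ0 : φ 0 = 0 := by
    simp only [hφ_def, sub_zero, h2cT, Real.log_one, mul_zero]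
  have hu0 : u 0 = m := by
    have e0 : NormedSpace.exp ((0 : ℝ) • W) = (1 : EuclideanSpace ℝ (Fin 3) →L[ℝ] EuclideanSpace ℝ (Fin 3)) := by
      have hz : (0 : ℝ) • W = 0 := by ext v; simp
      rw [hz, NormedSpace.exp_zero]
    funext x
    simp only [hu_def, hlam0, one_smul, hRot, hRot', hφ0, neg_zero, e0]
    rfl
  -- `m` does not vanish identically
  have hm_ne : m ≠ 0 := by
    intro hm0
    have : (∫ x, ‖curl m x‖ ^ 2) = 0 := by
      simp [hm0, curl_zero]
    linarith
  obtain ⟨ystar, hystar⟩ : ∃ y, m y ≠ 0 := by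
    obtain ⟨y, hy⟩ := Function.ne_iff.1 hm_ne
    exact ⟨y, by simpa using hy⟩
  -- `m` is bounded (`H² ⊂ L^∞`)
  obtain ⟨B, hB0, hB⟩ : ∃ B : ℝ, 0 ≤ B ∧ ∀ x, ‖m x‖ ≤ B := by
    have hg : ∀ t ∈ ({0} : Set ℝ), ContDiff ℝ 2 ((fun _ : ℝ => m) t) := fun _ _ => contDiff_infty.1 hm 2
    have hH : ∀ j < 3, ∃ C : ℝ≥0, ∀ t ∈ ({0} : Set ℝ),
        ∫⁻ x, ‖iteratedFDeriv ℝ j ((fun _ : ℝ => m) t) x‖ₑ ^ 2 ≤ C := by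
      intro j hj
      have hfin : ∫⁻ x, ‖iteratedFDeriv ℝ j m x‖ₑ ^ 2 < ⊤ := by
        interval_cases j
        · exact h0
        · exact h1
        · exact h2
      exact ⟨(∫⁻ x, ‖iteratedFDeriv ℝ j m x‖ₑ ^ 2).toNNReal, fun _ _ =>
        le_of_eq (ENNReal.coe_toNNReal hfin.ne).symm⟩
    obtain ⟨B, hB0, hB⟩ := exists_forall_norm_le_of_sobolev_bounds hg hH
    exact ⟨B, hB0, fun x => hB 0 (mem_singleton 0) x⟩
  -- `m ∈ L² ∩ L⁶ ⊂ L³`, and `∫|m|² < ∞`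
  have h0' : ∫⁻ x, ‖m x‖ₑ ^ 2 < ⊤ := by
    refine lt_of_le_of_lt (le_of_eq (lintegral_congr fun x => ?_)) h0
    rw [← ofReal_norm, ← norm_iteratedFDeriv_zero (𝕜 := ℝ) (f := m), ofReal_norm]
  have m2 : MemLp m 2 volume :=
    (memLp_two_iff_integrable_sq_norm hmc.aestronglyMeasurable).2 (integrable_sq_norm_of_lintegral_lt_top hmc h0')
  have m6 : MemLp m 6 volume := memLp_six hm h0 h1 h2
  have m3 : MemLp m 3 volume := by
    have h := memLp_of_memLp_two_of_memLp_six m2 m6 (k := 3) (by norm_num) (by norm_num)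
    simpa using h
  -- energy of the slices: `∫|u(t)|² = λ⁻¹ ∫|m|² ≤ ∫|m|²` on `[0, T)`
  have henergy : ∀ t, 0 ≤ t → t < T → ∫⁻ x, ‖u t x‖ₑ ^ 2 ≤ ∫⁻ y, ‖m y‖ₑ ^ 2 := by
    intro t ht0 htT
    have hl := hlam_pos t htT
    have hpt : ∀ x, ‖u t x‖ₑ ^ 2 = ENNReal.ofReal (lam t) ^ 2 *
        (fun y => ‖m y‖ₑ ^ 2) (lam t • (Rot t).symm x) := by
      intro x
      have hn : ‖u t x‖ = lam t * ‖m (lam t • (Rot t).symm x)‖ := by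
        rw [hu_def]
        simp only [norm_smul, LinearIsometryEquiv.norm_map, Real.norm_eq_abs, abs_of_pos hl]
      rw [← ofReal_norm, hn, ENNReal.ofReal_mul hl.le, ofReal_norm, mul_pow]
    simp_rw [hpt]
    have hcv := lintegral_comp_smul_isometry (fun y => ‖m y‖ₑ ^ 2) (Rot t) hl.ne'
    rw [lintegral_const_mul' _ _ (by simp), hcv, ← mul_assoc]
    have hfac : ENNReal.ofReal (lam t) ^ 2 * ENNReal.ofReal |(lam t ^ 3)⁻¹| ≤ 1 := by
      rw [← ENNReal.ofReal_pow hl.le, abs_of_pos (inv_pos.2 (pow_pos hl 3)),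
        ← ENNReal.ofReal_mul (pow_pos hl 2).le, ← ENNReal.ofReal_one]
      refine ENNReal.ofReal_le_ofReal ?_
      rw [show lam t ^ 2 * (lam t ^ 3)⁻¹ = (lam t)⁻¹ by field_simp]
      exact inv_le_one_of_one_le₀ (hlam_ge t ht0 htT)
    exact mul_le_of_le_one_left bot_le hfac
  -- Leray–Hopf on every `[0, T']`, then on `[0, T]` with the weak final slice
  have hLH' : ∀ T' ∈ Ioo 0 T, IsLerayHopfOn T' ν 0 (u 0) u := by
    intro T' hT'
    have hsub : Icc 0 T' ⊆ Iio T := fun t ht => lt_of_le_of_lt ht.2 hT'.2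
    have hclT : IsClassicalNSSolutionOn (Icc 0 T') ν 0 u p := hcl.mono hsub (uniqueDiffOn_Icc hT'.1)
    refine (isLerayHopfOn_of_finiteEnergy hclT hν hT'.1 ⟨∫⁻ y, ‖m y‖ₑ ^ 2, h0', fun t ht => ?_⟩).1
    exact henergy t ht.1 (lt_of_le_of_lt ht.2 hT'.2)
  obtain ⟨Y, -, hLH⟩ := exists_isLerayHopfOn_update_of_forall_lt hT hν hLH'
  set ut := Function.update u T Y with hut_def
  have hut_lt : ∀ {t : ℝ}, t < T → ut t = u t := fun ht => Function.update_of_ne ht.ne Y u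
  have hut0 : ut 0 = u 0 := hut_lt hT
  -- the updated field is still a maximal classical solution on `[0, T)`
  have hcl0' : IsClassicalNSSolutionOn (Ico 0 T) ν 0 ut p := hcl0.congr_velocity fun t ht => hut_lt ht.2
  have hmax' : IsMaximalSmoothSolution ν 0 ut p T := by
    refine ⟨hcl0', not_hasSmoothExtensionPast_of_selfSimilarOrbit hT lam Rot m ystar hystar hlam_tend ?_⟩
    intro t ht x
    rw [hut_lt ht.2]
  have hLH'' : IsLerayHopfOn T ν 0 (ut 0) ut := by rw [hut0]; exact hLH
  have h3 : MemLp (ut 0) 3 volume := by rw [hut0, hu0]; exact m3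
  -- boundedness on closed sub-slabs
  have hbdd : ∀ T' ∈ Ioo 0 T, eLpNorm (uncurry ut) (⊤ : ℝ≥0∞) (volume.restrict (Icc 0 T' ×ˢ univ)) < ⊤ := by
    intro T' hT'
    have hmeas : MeasurableSet (Icc (0 : ℝ) T' ×ˢ (univ : Set (EuclideanSpace ℝ (Fin 3)))) :=
      measurableSet_Icc.prod MeasurableSet.univ
    have hbound : ∀ q ∈ Icc (0 : ℝ) T' ×ˢ (univ : Set (EuclideanSpace ℝ (Fin 3))),
        ‖uncurry ut q‖ ≤ lam T' * B := by
      rintro ⟨t, x⟩ hq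
      have ht : t ∈ Icc 0 T' := (mem_prod.1 hq).1
      have htT : t < T := lt_of_le_of_lt ht.2 hT'.2
      have hl := hlam_pos t htT
      rw [uncurry_apply_pair, hut_lt htT, hu_def]
      simp only [norm_smul, LinearIsometryEquiv.norm_map, Real.norm_eq_abs, abs_of_pos hl]
      exact mul_le_mul (hlam_mono t T' ht.2 hT'.2) (hB _) (norm_nonneg _) (hl.le.trans (hlam_mono t T' ht.2 hT'.2))
    rw [eLpNorm_exponent_top]
    refine eLpNormEssSup_lt_top_of_ae_bound (C := lam T' * B) ?_
    exact (ae_restrict_iff' hmeas).2 (ae_of_all _ hbound)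
  -- Seregin: `‖u(t)‖₃ → ∞`; but it is constant `= ‖m‖₃ < ∞`
  have hS := seregin_L3_blowup_holds hν hT hmax' hLH'' h3 hbdd
  have hconst : (fun t => eLpNorm (ut t) 3 volume) =ᶠ[𝓝[<] T] fun _ => eLpNorm m 3 volume := by
    filter_upwards [self_mem_nhdsWithin] with t ht
    have htT : t < T := ht
    rw [hut_lt htT]
    exact eLpNorm_three_selfSimilarSlice m (Rot t) (hlam_pos t htT)
  have hlim : Tendsto (fun t => eLpNorm (ut t) 3 volume) (𝓝[<] T) (𝓝 (eLpNorm m 3 volume)) :=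
    tendsto_const_nhds.congr' hconst.symm
  exact m3.eLpNorm_lt_top.ne (tendsto_nhds_unique hlim hS)

/-- **(L⁺_rot) — PROVED** (with drift: `rotatingCollapseLiouville_of_noDrift` + the driftless theorem). Verbatim the
hypothesis `hL` of `maximiserSetRigidity_of_partA_of_rotatingCollapseLiouville`. [folklore] -/
theorem rotatingCollapseLiouville_holds :
    ∀ (ν : ℝ), 0 < ν → ∀ (m : EuclideanSpace ℝ (Fin 3) → EuclideanSpace ℝ (Fin 3)) (π : EuclideanSpace ℝ (Fin 3) → ℝ)
      (a : EuclideanSpace ℝ (Fin 3)) (W : EuclideanSpace ℝ (Fin 3) →L[ℝ] EuclideanSpace ℝ (Fin 3)) (c' : ℝ),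
      (ContDiff ℝ (⊤ : ℕ∞) m ∧ Literature.Analysis.FluidPDE.VectorCalculus.IsDivFree m ∧ (∫⁻ x,
        ‖iteratedFDeriv ℝ 0 m x‖ₑ ^ 2 < ⊤) ∧ (∫⁻ x, ‖iteratedFDeriv ℝ 1 m x‖ₑ ^ 2 < ⊤) ∧ (∫⁻ x, ‖iteratedFDeriv ℝ
        2 m x‖ₑ ^ 2 < ⊤)) → 0 < (∫ x, ‖Literature.Analysis.FluidPDE.curl m x‖ ^ 2) → ContDiff ℝ (⊤ : ℕ∞) π → (∀ x
        y : EuclideanSpace ℝ (Fin 3), ⟪W x, y⟫_ℝ = -⟪x, W y⟫_ℝ) → W ≠ 0 → 0 < c' → ¬ (∀ x : EuclideanSpace ℝ (Fin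
        3), ν • Laplacian.laplacian m x - Literature.Analysis.FluidPDE.convect m m x - gradient π x = fderiv ℝ m x
        a + (fderiv ℝ m x (W x) - W (m x)) + c' • (m x + fderiv ℝ m x x)) :=
  rotatingCollapseLiouville_of_noDrift rotatingCollapseLiouville_noDrift_holds

/-- **Part (b) of `MaximiserSetRigidity` — UNCONDITIONAL.** For `c, ν > 0` and every `m` satisfying the item's
normalised-maximiser clause verbatim: for all smooth `π`, all drifts `a`, all skew-adjoint `W` and all `c′ ∈ ℝ`, `m`
is NOT a relative equilibrium `νΔm − (m·∇)m − ∇π = (a·∇)m + ((Wx)·∇)m − Wm + c′(m + (x·∇)m)` — no normalised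
Lu–Doering maximiser is a steady / travelling / rotating / self-similarly collapsing or expanding Navier–Stokes profile
(`partB_of_rotatingCollapseLiouville` with (L⁺_rot) discharged). [folklore] -/
theorem partB_holds (c ν : ℝ) (hc : 0 < c) (hν : 0 < ν)
    (m : EuclideanSpace ℝ (Fin 3) → EuclideanSpace ℝ (Fin 3))
    (hm : ((ContDiff ℝ (⊤ : ℕ∞) m ∧ Literature.Analysis.FluidPDE.VectorCalculus.IsDivFree m ∧ (∫⁻ x, ‖iteratedFDeriv ℝ 0
      m x‖ₑ ^ 2 < ⊤) ∧ (∫⁻ x, ‖iteratedFDeriv ℝ 1 m x‖ₑ ^ 2 < ⊤) ∧ (∫⁻ x, ‖iteratedFDeriv ℝ 2 m x‖ₑ ^ 2 < ⊤))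
      ∧ 0 < (∫ x, ‖Literature.Analysis.FluidPDE.curl m x‖ ^ 2) ∧ (∫ x, ⟪Literature.Analysis.FluidPDE.curl m x,
      fderiv ℝ m x (Literature.Analysis.FluidPDE.curl m x)⟫_ℝ) = c * (∫ x, ‖Literature.Analysis.FluidPDE.curl
      m x‖ ^ 2) ^ (3 / 4 : ℝ) * (∫ x, Literature.Analysis.FluidPDE.frobeniusNormSq (fderiv ℝ
      (Literature.Analysis.FluidPDE.curl m) x)) ^ (3 / 4 : ℝ) ∧ (∫ x,
      Literature.Analysis.FluidPDE.frobeniusNormSq (fderiv ℝ (Literature.Analysis.FluidPDE.curl m) x)) = 81 *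
      c ^ 4 / (256 * ν ^ 4) * (∫ x, ‖Literature.Analysis.FluidPDE.curl m x‖ ^ 2) ^ 3)) :
    ∀ (π : EuclideanSpace ℝ (Fin 3) → ℝ) (a : EuclideanSpace ℝ (Fin 3)) (W : EuclideanSpace ℝ (Fin 3) →L[ℝ]
    EuclideanSpace ℝ (Fin 3)) (c' : ℝ), ContDiff ℝ (⊤ : ℕ∞) π → (∀ x y : EuclideanSpace ℝ (Fin 3), ⟪W x, y⟫_ℝ
    = -⟪x, W y⟫_ℝ) → ¬ (∀ x : EuclideanSpace ℝ (Fin 3), ν • Laplacian.laplacian m x -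
    Literature.Analysis.FluidPDE.convect m m x - gradient π x = fderiv ℝ m x a + (fderiv ℝ m x (W x) - W (m
    x)) + c' • (m x + fderiv ℝ m x x)) :=
  partB_of_rotatingCollapseLiouville c ν hc hν (rotatingCollapseLiouville_holds ν hν) m hm

/-- **`MaximiserSetRigidity` ⟸ its clause (a) ALONE** — BY NAME against the route decl. Clause (a) (finitely many
normalised Lu–Doering maximisers modulo translations, linear isometries and scaling — the BET) is the only open
content of stmt-25512; clause (b) is `partB_holds`. [folklore] -/
theorem maximiserSetRigidity_of_partA
    (hA : ∀ c ν : ℝ, (0 < c ∧ (∀ v : EuclideanSpace ℝ (Fin 3) → EuclideanSpace ℝ (Fin 3), (ContDiff ℝ (⊤ : ℕ∞) v ∧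
      Literature.Analysis.FluidPDE.VectorCalculus.IsDivFree v ∧ (∫⁻ x, ‖iteratedFDeriv ℝ 0 v x‖ₑ ^ 2 < ⊤) ∧
      (∫⁻ x, ‖iteratedFDeriv ℝ 1 v x‖ₑ ^ 2 < ⊤) ∧ (∫⁻ x, ‖iteratedFDeriv ℝ 2 v x‖ₑ ^ 2 < ⊤)) → (∫ x,
      ⟪Literature.Analysis.FluidPDE.curl v x, fderiv ℝ v x (Literature.Analysis.FluidPDE.curl v x)⟫_ℝ) ≤ c *
      (∫ x, ‖Literature.Analysis.FluidPDE.curl v x‖ ^ 2) ^ (3 / 4 : ℝ) * (∫ x,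
      Literature.Analysis.FluidPDE.frobeniusNormSq (fderiv ℝ (Literature.Analysis.FluidPDE.curl v) x)) ^ (3 / 4
      : ℝ)) ∧ ∀ c' : ℝ, (∀ w : EuclideanSpace ℝ (Fin 3) → EuclideanSpace ℝ (Fin 3), (ContDiff ℝ (⊤ : ℕ∞) w ∧
      Literature.Analysis.FluidPDE.VectorCalculus.IsDivFree w ∧ (∫⁻ x, ‖iteratedFDeriv ℝ 0 w x‖ₑ ^ 2 < ⊤) ∧
      (∫⁻ x, ‖iteratedFDeriv ℝ 1 w x‖ₑ ^ 2 < ⊤) ∧ (∫⁻ x, ‖iteratedFDeriv ℝ 2 w x‖ₑ ^ 2 < ⊤)) → (∫ x,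
      ⟪Literature.Analysis.FluidPDE.curl w x, fderiv ℝ w x (Literature.Analysis.FluidPDE.curl w x)⟫_ℝ) ≤ c' *
      (∫ x, ‖Literature.Analysis.FluidPDE.curl w x‖ ^ 2) ^ (3 / 4 : ℝ) * (∫ x,
      Literature.Analysis.FluidPDE.frobeniusNormSq (fderiv ℝ (Literature.Analysis.FluidPDE.curl w) x)) ^ (3 / 4
      : ℝ)) → c ≤ c') → 0 < ν → ∃ (k : ℕ) (ms : Fin k → EuclideanSpace ℝ (Fin 3) → EuclideanSpace ℝ (Fin 3)), (∀
      i, ((ContDiff ℝ (⊤ : ℕ∞) (ms i) ∧ Literature.Analysis.FluidPDE.VectorCalculus.IsDivFree (ms i) ∧ (∫⁻ x,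
      ‖iteratedFDeriv ℝ 0 (ms i) x‖ₑ ^ 2 < ⊤) ∧ (∫⁻ x, ‖iteratedFDeriv ℝ 1 (ms i) x‖ₑ ^ 2 < ⊤) ∧ (∫⁻ x,
      ‖iteratedFDeriv ℝ 2 (ms i) x‖ₑ ^ 2 < ⊤)) ∧ 0 < (∫ x, ‖Literature.Analysis.FluidPDE.curl (ms i) x‖ ^ 2) ∧
      (∫ x, ⟪Literature.Analysis.FluidPDE.curl (ms i) x, fderiv ℝ (ms i) x (Literature.Analysis.FluidPDE.curl
      (ms i) x)⟫_ℝ) = c * (∫ x, ‖Literature.Analysis.FluidPDE.curl (ms i) x‖ ^ 2) ^ (3 / 4 : ℝ) * (∫ x,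
      Literature.Analysis.FluidPDE.frobeniusNormSq (fderiv ℝ (Literature.Analysis.FluidPDE.curl (ms i)) x)) ^ (3
      / 4 : ℝ) ∧ (∫ x, Literature.Analysis.FluidPDE.frobeniusNormSq (fderiv ℝ (Literature.Analysis.FluidPDE.curl
      (ms i)) x)) = 81 * c ^ 4 / (256 * ν ^ 4) * (∫ x, ‖Literature.Analysis.FluidPDE.curl (ms i) x‖ ^ 2) ^ 3)) ∧
      ∀ m : EuclideanSpace ℝ (Fin 3) → EuclideanSpace ℝ (Fin 3), ((ContDiff ℝ (⊤ : ℕ∞) m ∧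
      Literature.Analysis.FluidPDE.VectorCalculus.IsDivFree m ∧ (∫⁻ x, ‖iteratedFDeriv ℝ 0 m x‖ₑ ^ 2 < ⊤) ∧
      (∫⁻ x, ‖iteratedFDeriv ℝ 1 m x‖ₑ ^ 2 < ⊤) ∧ (∫⁻ x, ‖iteratedFDeriv ℝ 2 m x‖ₑ ^ 2 < ⊤)) ∧ 0 < (∫ x,
      ‖Literature.Analysis.FluidPDE.curl m x‖ ^ 2) ∧ (∫ x, ⟪Literature.Analysis.FluidPDE.curl m x, fderiv ℝ m x
      (Literature.Analysis.FluidPDE.curl m x)⟫_ℝ) = c * (∫ x, ‖Literature.Analysis.FluidPDE.curl m x‖ ^ 2) ^ (3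
      / 4 : ℝ) * (∫ x, Literature.Analysis.FluidPDE.frobeniusNormSq (fderiv ℝ (Literature.Analysis.FluidPDE.curl
      m) x)) ^ (3 / 4 : ℝ) ∧ (∫ x, Literature.Analysis.FluidPDE.frobeniusNormSq (fderiv ℝ
      (Literature.Analysis.FluidPDE.curl m) x)) = 81 * c ^ 4 / (256 * ν ^ 4) * (∫ x,
      ‖Literature.Analysis.FluidPDE.curl m x‖ ^ 2) ^ 3) → (∃ (i : Fin k) (a : EuclideanSpace ℝ (Fin 3)) (R :
      EuclideanSpace ℝ (Fin 3) ≃ₗᵢ[ℝ] EuclideanSpace ℝ (Fin 3)) (l : ℝ), 0 < l ∧ m = fun x => l • R (ms i (l •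
      R.symm (x - a))))) :
    Summit.NavierStokesRegularity.NavierStokesRegularity.Theses.EfficiencyFloor.MaximiserSetRigidity :=
  maximiserSetRigidity_of_partA_of_rotatingCollapseLiouville hA rotatingCollapseLiouville_holds

end ProfileLiouville

end MaximiserSetRigidity

end Summit.NavierStokesRegularity.NavierStokesRegularity.Theorems

end
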